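import Mathlib
import HarnessLib
import Literature.AlgebraicGeometry.HyperbolicPolynomials.SpectrahedralShadow
import Summits.ValiantsHypothesis.ValiantsHypothesis.Theorems.PermanentalConesHyperbolicVPShadowStubRealifyHermitianPencil
import Summits.ValiantsHypothesis.ValiantsHypothesis.Theorems.PermanentalConesHyperbolicVPShadowStubSpectrahedronOfSymmDetPower

/-!
# ValiantsHypothesis / PermanentalCones — `HyperbolicVPShadow`, stub D₃ʰ

Route `PermanentalCones`, item `stmt-ValiantsHypothesis-8655` (crux `HyperbolicVPShadow`), line
`birth`, stub `stub_oshimeFamilyD3h_spectrahedron`.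

Family (D3) of Oshime's classification of non-symmetrisable linear pencils of real `3 × 3`
matrices with only real eigenvalues (Oshime 1991, part (II), Prop. 5.12 / Thm. 6.3 (3)), in
homogenised form, is the `4`-variable pencil `P(x) = x₀ 1 + x₁ A + x₂ B + x₃ C` with
`A = E₁₁ + E₂₃ = !![1, 0, 0; 0, 0, 1; 0, 0, 0]`, `B = !![2a − 1, 1, −a; a, 0, 0; −1, 0, 0]`,
`C = !![2δ, 1, γ − δ; γ + δ, 1, 0; 1, 0, −1]`; it has only real eigenvalues iff `2a − 1 ≥ 0`,
`1 + 2γ ≥ 0` and `δ² ≤ (2a − 1)(1 + 2γ)`. We show that under these hypotheses its closed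
nonnegative-spectrum cone `{x : ∀ τ > 0, det (P x + τ·1) ≠ 0}` is a lifted-LMI set of size `6`.

## Proof

With `t := τ + x₀` one has
`det (P x + τ·1) = (t − x₂)·[(t + x₁ + (2a−1) x₂ + 2δ x₃)(t + x₂) − R₁]`,
`R₁ := (2a−1) x₂² + 2δ x₂ x₃ + (1+2γ) x₃²`. There is a *Hermitian* determinantal certificate:
real numbers `r, p, q` with `r² = 2a − 1`, `r p = δ`, `p² + q² = 1 + 2γ`
(`permanentalCones_oshimeD3_certificate`: `r = √(2a−1)`; if `2a − 1 = 0` then `δ = 0` and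
`p = 0`, `q = √(1+2γ)`; otherwise `p = δ / r`, `q = √(1 + 2γ − p²)`). For the Hermitian pencil
`H(x) + τ·1 = !![t + x₁ + (2a−1) x₂ + 2δ x₃, r x₂ + (p + q i) x₃, 0; r x₂ + (p − q i) x₃, t + x₂, 0;
0, 0, t − x₂]` one has `det (H x + τ·1) = det (P x + τ·1)` identically
(`permanentalCones_oshimeD3_detIdentity`, a polynomial identity modulo the three relations).
Realifying the Hermitian pencil (`stub_realify_hermitianPencil`) gives a real symmetric pencil
`L` of size `2·3` with `det (L x + τ·1) = det (P x + τ·1)²`, and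
`stub_spectrahedron_of_symmDetPower` (`k = 2`) turns this into a size-`6` lifted-LMI description
of the cone. No definitions are introduced: all matrices are literals, the two pencils are
`Fintype.linearCombination ℝ ![…]`.
-/

-- `<Problem> = <Summit>` for this single-conjunct summit (lakefile sets the same option tree-wide).
set_option linter.dupNamespace false

namespace Summit.ValiantsHypothesis.ValiantsHypothesis.Theorems

open Matrix Complex

/-- **Parameters of the Hermitian certificate for Oshime's family (D3).** If `1 ≤ 2a`,
`0 ≤ 1 + 2γ` and `δ² ≤ (2a − 1)(1 + 2γ)`, then there are real `r, p, q` with `r² = 2a − 1`,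
`r p = δ` and `p² + q² = 1 + 2γ` (certificate for Oshime 1991 (II), Prop. 5.12, family (D3)).
[folklore] -/
theorem permanentalCones_oshimeD3_certificate (a γ δ : ℝ) (h2a : 1 ≤ 2 * a)
    (hγ : 0 ≤ 1 + 2 * γ) (hδ : δ ^ 2 ≤ (2 * a - 1) * (1 + 2 * γ)) :
    ∃ r p q : ℝ, r ^ 2 = 2 * a - 1 ∧ r * p = δ ∧ p ^ 2 + q ^ 2 = 1 + 2 * γ := by
  have h2a' : 0 ≤ 2 * a - 1 := by linarith
  rcases eq_or_lt_of_le h2a' with h0 | hpos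
  · -- degenerate case `2a - 1 = 0`: then `δ = 0`
    have hδ0 : δ = 0 := by
      have h : δ ^ 2 ≤ 0 := by rw [← h0, zero_mul] at hδ; exact hδ
      exact pow_eq_zero_iff (n := 2) two_ne_zero |>.1 (le_antisymm h (sq_nonneg δ))
    refine ⟨0, 0, Real.sqrt (1 + 2 * γ), ?_, ?_, ?_⟩
    · rw [← h0]; ring
    · rw [hδ0]; ring
    · rw [Real.sq_sqrt hγ]; ring
  · -- generic case `2a - 1 > 0`
    obtain ⟨r, hr0, hr⟩ : ∃ r : ℝ, 0 < r ∧ r ^ 2 = 2 * a - 1 :=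
      ⟨Real.sqrt _, Real.sqrt_pos.2 hpos, Real.sq_sqrt hpos.le⟩
    obtain ⟨p, hp⟩ : ∃ p : ℝ, p = δ / r := ⟨_, rfl⟩
    have hr0' : r ≠ 0 := hr0.ne'
    have R2 : r * p = δ := by rw [hp]; field_simp
    have hq2 : 0 ≤ 1 + 2 * γ - p ^ 2 := by
      -- `r² (1 + 2γ - p²) = (2a-1)(1+2γ) - δ² ≥ 0`
      have hkey : r ^ 2 * (1 + 2 * γ - p ^ 2) = (2 * a - 1) * (1 + 2 * γ) - δ ^ 2 := by
        rw [← R2, ← hr]; ring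
      have hnn : 0 ≤ r ^ 2 * (1 + 2 * γ - p ^ 2) := by rw [hkey]; linarith
      exact le_of_mul_le_mul_left (by simpa using hnn) (pow_pos hr0 2)
    refine ⟨r, p, Real.sqrt (1 + 2 * γ - p ^ 2), hr, R2, ?_⟩
    rw [Real.sq_sqrt hq2]; ring

/-- **The Hermitian determinantal identity for Oshime's family (D3).** Under the three relations
of `permanentalCones_oshimeD3_certificate`,
`det (t·1 + x₀·1 + x₁ E₁₁ + x₂ G₂ + x₃ G₃) = det (t·1 + x₀·1 + x₁ A + x₂ B + x₃ C)` for the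
Hermitian matrices `G₂ = !![2a − 1, r, 0; r, 1, 0; 0, 0, −1]`,
`G₃ = !![2δ, p + q i, 0; p − q i, 0, 0; 0, 0, 0]`, both sides written out as explicit `3 × 3`
matrices (Oshime 1991 (II), Prop. 5.12, family (D3)). [folklore] -/
theorem permanentalCones_oshimeD3_detIdentity (a γ δ r p q : ℝ)
    (R1 : r ^ 2 = 2 * a - 1) (R2 : r * p = δ) (R3 : p ^ 2 + q ^ 2 = 1 + 2 * γ)
    (t x₀ x₁ x₂ x₃ : ℝ) :
    (!![(t : ℂ) + x₀ + x₁ + (2 * a - 1) * x₂ + 2 * δ * x₃, r * x₂ + (p + q * I) * x₃, 0;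
        r * x₂ + (p - q * I) * x₃, t + x₀ + x₂, 0;
        0, 0, t + x₀ - x₂]).det =
      ((!![t + x₀ + x₁ + (2 * a - 1) * x₂ + 2 * δ * x₃, x₂ + x₃, -a * x₂ + (γ - δ) * x₃;
          a * x₂ + (γ + δ) * x₃, t + x₀ + x₃, x₁;
          -x₂ + x₃, 0, t + x₀ - x₃]).det : ℂ) := by
  have R1c : (r : ℂ) ^ 2 = 2 * a - 1 := by exact_mod_cast R1
  have R2c : (r : ℂ) * p = δ := by exact_mod_cast R2
  have R3c : (p : ℂ) ^ 2 + q ^ 2 = 1 + 2 * γ := by exact_mod_cast R3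
  simp only [Matrix.det_fin_three, Matrix.of_apply, Matrix.cons_val', Matrix.cons_val_zero,
    Matrix.cons_val_one, Matrix.cons_val_two, Matrix.head_cons, Matrix.tail_cons,
    Matrix.empty_val', Matrix.cons_val_fin_one, Matrix.head_fin_const]
  push_cast
  -- with `s := t + x₀` the two expansions differ by
  -- `-(s - x₂)·[(r² - (2a-1)) x₂² + 2 (r p - δ) x₂ x₃ + (p² + q² - (1+2γ)) x₃²]`
  -- plus a multiple of `I² + 1`
  linear_combination (-((t : ℂ) + x₀ - x₂) * x₂ ^ 2) * R1c
    + (-2 * ((t : ℂ) + x₀ - x₂) * x₂ * x₃) * R2c + (-((t : ℂ) + x₀ - x₂) * x₃ ^ 2) * R3c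
    + (((t : ℂ) + x₀ - x₂) * q ^ 2 * x₃ ^ 2) * I_sq

/-- **Stub (Oshime's family (D3), homogenised, has size-`6` spectrahedral cones).** For
`1 ≤ 2a`, `0 ≤ 1 + 2γ`, `δ² ≤ (2a − 1)(1 + 2γ)`, the closed nonnegative-spectrum cone
`{x : ∀ τ > 0, det (x₀ 1 + x₁ A + x₂ B + x₃ C + τ·1) ≠ 0}` of the real-spectrum pencil
`A = E₁₁ + E₂₃`, `B = !![2a − 1, 1, −a; a, 0, 0; −1, 0, 0]`,
`C = !![2δ, 1, γ − δ; γ + δ, 1, 0; 1, 0, −1]` (Oshime 1991 (II), Prop. 5.12 / Thm. 6.3 (3),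
family (D3)) is a lifted-LMI set of size `6`: a Hermitian `3 × 3` determinantal representation,
realified to a symmetric `6 × 6` representation of the square of `det (P x + τ·1)`. [folklore] -/
theorem stub_oshimeFamilyD3h_spectrahedron :
    ∀ a γ δ : ℝ, 1 ≤ 2 * a → 0 ≤ 1 + 2 * γ → δ ^ 2 ≤ (2 * a - 1) * (1 + 2 * γ) →
      Literature.AlgebraicGeometry.HyperbolicPolynomials.IsSpectrahedralShadowOfSize
        {x : Fin 4 → ℝ | ∀ τ : ℝ, 0 < τ →
          (x 0 • (1 : Matrix (Fin 3) (Fin 3) ℝ) + x 1 • !![(1 : ℝ), 0, 0; 0, 0, 1; 0, 0, 0] +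
            x 2 • !![2 * a - 1, 1, -a; a, 0, 0; -1, 0, 0] +
            x 3 • !![2 * δ, 1, γ - δ; γ + δ, 1, 0; 1, 0, -1] +
            τ • (1 : Matrix (Fin 3) (Fin 3) ℝ)).det ≠ 0} 6 := by
  intro a γ δ h2a hγ hδ
  obtain ⟨r, p, q, R1, R2, R3⟩ := permanentalCones_oshimeD3_certificate a γ δ h2a hγ hδ
  -- the real pencil `P x = x 0 • 1 + x 1 • A + x 2 • B + x 3 • C`
  let P : (Fin 4 → ℝ) →ₗ[ℝ] Matrix (Fin 3) (Fin 3) ℝ := Fintype.linearCombination ℝ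
    ![(1 : Matrix (Fin 3) (Fin 3) ℝ), !![(1 : ℝ), 0, 0; 0, 0, 1; 0, 0, 0],
      !![2 * a - 1, 1, -a; a, 0, 0; -1, 0, 0], !![2 * δ, 1, γ - δ; γ + δ, 1, 0; 1, 0, -1]]
  have hP : ∀ x : Fin 4 → ℝ, P x = x 0 • (1 : Matrix (Fin 3) (Fin 3) ℝ) +
      x 1 • !![(1 : ℝ), 0, 0; 0, 0, 1; 0, 0, 0] + x 2 • !![2 * a - 1, 1, -a; a, 0, 0; -1, 0, 0] +
      x 3 • !![2 * δ, 1, γ - δ; γ + δ, 1, 0; 1, 0, -1] := fun x => by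
    simp only [P, Fintype.linearCombination_apply, Fin.sum_univ_four, Matrix.cons_val_zero,
      Matrix.cons_val_one, Matrix.cons_val_two, Matrix.cons_val, Matrix.head_cons,
      Matrix.tail_cons]
  have hPx : ∀ (x : Fin 4 → ℝ) (τ : ℝ), P x + τ • (1 : Matrix (Fin 3) (Fin 3) ℝ) =
      !![τ + x 0 + x 1 + (2 * a - 1) * x 2 + 2 * δ * x 3, x 2 + x 3, -a * x 2 + (γ - δ) * x 3;
        a * x 2 + (γ + δ) * x 3, τ + x 0 + x 3, x 1;
        -x 2 + x 3, 0, τ + x 0 - x 3] := fun x τ => by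
    rw [hP]
    ext i j
    fin_cases i <;> fin_cases j <;> simp <;> ring
  -- the Hermitian pencil `H x = x 0 • 1 + x 1 • E₁₁ + x 2 • G₂ + x 3 • G₃`
  let G₁ : Matrix (Fin 3) (Fin 3) ℂ := !![1, 0, 0; 0, 0, 0; 0, 0, 0]
  let G₂ : Matrix (Fin 3) (Fin 3) ℂ := !![2 * (a : ℂ) - 1, (r : ℂ), 0; (r : ℂ), 1, 0; 0, 0, -1]
  let G₃ : Matrix (Fin 3) (Fin 3) ℂ :=
    !![2 * (δ : ℂ), (p : ℂ) + q * I, 0; (p : ℂ) - q * I, 0, 0; 0, 0, 0]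
  have h1h : (1 : Matrix (Fin 3) (Fin 3) ℂ).IsHermitian := Matrix.isHermitian_one
  have hG₁h : G₁.IsHermitian := Matrix.IsHermitian.ext fun i j => by
    fin_cases i <;> fin_cases j <;> simp [G₁]
  have hG₂h : G₂.IsHermitian := Matrix.IsHermitian.ext fun i j => by
    fin_cases i <;> fin_cases j <;> simp [G₂]
  have hG₃h : G₃.IsHermitian := Matrix.IsHermitian.ext fun i j => by
    fin_cases i <;> fin_cases j <;> simp [G₃, Complex.ext_iff]
  let H : (Fin 4 → ℝ) →ₗ[ℝ] Matrix (Fin 3) (Fin 3) ℂ :=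
    Fintype.linearCombination ℝ ![(1 : Matrix (Fin 3) (Fin 3) ℂ), G₁, G₂, G₃]
  have hH : ∀ x : Fin 4 → ℝ, H x = x 0 • (1 : Matrix (Fin 3) (Fin 3) ℂ) + x 1 • G₁ + x 2 • G₂ +
      x 3 • G₃ := fun x => by
    simp only [H, Fintype.linearCombination_apply, Fin.sum_univ_four, Matrix.cons_val_zero,
      Matrix.cons_val_one, Matrix.cons_val_two, Matrix.cons_val, Matrix.head_cons,
      Matrix.tail_cons]
  have hHerm : ∀ x : Fin 4 → ℝ, (H x).IsHermitian := fun x => by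
    rw [hH]
    exact (((h1h.smul (IsSelfAdjoint.all _)).add (hG₁h.smul (IsSelfAdjoint.all _))).add
      (hG₂h.smul (IsSelfAdjoint.all _))).add (hG₃h.smul (IsSelfAdjoint.all _))
  have hHx : ∀ (x : Fin 4 → ℝ) (τ : ℝ), H x + (τ : ℂ) • (1 : Matrix (Fin 3) (Fin 3) ℂ) =
      !![(τ : ℂ) + x 0 + x 1 + (2 * a - 1) * x 2 + 2 * δ * x 3, r * x 2 + (p + q * I) * x 3, 0;
        r * x 2 + (p - q * I) * x 3, τ + x 0 + x 2, 0;
        0, 0, τ + x 0 - x 2] := fun x τ => by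
    rw [hH]
    ext i j
    fin_cases i <;> fin_cases j <;> simp [G₁, G₂, G₃, Matrix.smul_apply] <;> ring
  -- the determinantal identity `det (H x + τ·1) = det (P x + τ·1)`
  have hdet : ∀ (x : Fin 4 → ℝ) (τ : ℝ), (H x + (τ : ℂ) • (1 : Matrix (Fin 3) (Fin 3) ℂ)).det =
      (((P x + τ • (1 : Matrix (Fin 3) (Fin 3) ℝ)).det : ℝ) : ℂ) := fun x τ => by
    rw [hHx, hPx]
    exact permanentalCones_oshimeD3_detIdentity a γ δ r p q R1 R2 R3 τ (x 0) (x 1) (x 2) (x 3)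
  -- realification: a symmetric pencil of size `2·3` representing the square of `det (P x + τ·1)`
  obtain ⟨L, hLsymm, hLdet⟩ := stub_realify_hermitianPencil 4 3 H hHerm
  have hLdet' : ∀ (x : Fin 4 → ℝ) (τ : ℝ),
      (L x + τ • (1 : Matrix (Fin (2 * 3)) (Fin (2 * 3)) ℝ)).det =
        ((P x + τ • (1 : Matrix (Fin 3) (Fin 3) ℝ)).det) ^ 2 := fun x τ => by
    have h := hLdet x τ
    simp only [Complex.coe_algebraMap] at h
    have hs : star (((P x + τ • (1 : Matrix (Fin 3) (Fin 3) ℝ)).det : ℝ) : ℂ) =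
        ((P x + τ • (1 : Matrix (Fin 3) (Fin 3) ℝ)).det : ℝ) := Complex.conj_ofReal _
    rw [hdet x τ, hs, ← Complex.ofReal_mul] at h
    rw [sq]
    exact_mod_cast h
  have h6 := stub_spectrahedron_of_symmDetPower 4 3 (2 * 3) 2 P L two_ne_zero hLsymm hLdet'
  simp only [hP] at h6
  exact h6

end Summit.ValiantsHypothesis.ValiantsHypothesis.Theorems
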